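import Literature.MathematicalPhysics.QuantumLattice.Imbrie2016.ZeroCoupling
import Literature.MathematicalPhysics.QuantumLattice.FinDimSpectrumClusterGapProofs

/-!
# Imbrie (2016), Assumption LLA: the Weyl window — P_γ(min gap < δ) ≤ ρ₀ 4ⁿ (δ + 2|γ| n), and the consumed
instance of A2 for SMALL blocks is a theorem (audit-cell lemmas, kernel-checked)

CITATION HEADER (lean-in-tree rule 2026-08-18). J. Z. Imbrie, *On many-body localization for quantum spin chains*,
J. Stat. Phys. **163** (2016) 998–1048, doi 10.1007/s10955-016-1508-x, arXiv:1403.7837 [ImbrieJSP2016]: eq. (1.1) (model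
with + boundary conditions), p. 1000 (admissible laws), eq. (1.3) = (5.2) (Assumption LLA(ν, C)), §5 proof of Thm 5.1 (the
consumed instance "P(min_{α≠β}|E_α − E_β| < ε^{sϰn}) ≤ ε^{sνϰn} for a block of n sites in a box of ≤ mn sites", ε = γ^{1/20}).
Weyl's monotonicity theorem in counting form: R. Bhatia, *Matrix Analysis* (1997), Cor. III.2.6 (used through the landed
`card_eigenvalues_le_le_card_of_forms` / `card_eigenvalues_lt_le_card_of_forms` of `FinDimSpectrumClusterGapProofs`).
WHAT IS PROVED (lemmas of the audit cell `pub-imbrie`, LLA.md §3 P2 / REPAIR-CENSUS V10 — NOT statements of the paper, which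
assumes LLA and proves nothing about it):
  * `abs_re_inner_offDiag_le`: the transverse part γ Σ Γ_i S^x_i of (1.1) has quadratic form bounded by |γ| Σ_i |Γ_i| ‖x‖²
    (Schur test: every row/column of the flip matrix has at most one entry per site);
  * `exists_cfg_pair_of_smallGap`: if two eigenvalue indices of H(γ) are within δ, then two distinct CONFIGURATIONS have
    γ = 0 energies within δ + 2|γ| Σ_i |Γ_i| (Weyl monotonicity of the eigenvalue counting functions between H(γ) and the
    diagonal H(0), then the γ = 0 dictionary `eigs_zero_multiset`);
  * `boxMeasure_smallGap_le` (**P2, the Weyl window**): for laws admissible with density bound ρ₀ ≥ 0, every γ, box, n, δ: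
    P_γ(∃ α ≠ β : |E_α − E_β| < δ) ≤ ρ₀ 4ⁿ (δ + 2|γ| n)   (|Γ_i| ≤ 1 a.s.; then the γ = 0 count `boxMeasure_cfgClose_le`);
  * `smallBlocks_consumedA2` (**small blocks are free**): for 0 < ν < 1, s, ϰ > 0, m, and N with sνϰN ≤ 20 there is γ₀ > 0
    such that for all γ ∈ (0, γ₀], all blocks of n < N sites (n ≥ 1) and all boxes of n′ ∈ [n, mn] sites,
    P_γ(min gap < ε^{sϰn}) ≤ ε^{sνϰn}, ε = γ^{1/20} — i.e. the instance of A2 consumed by the proof of Thm 5.1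
    (`A2consumed` of `Imbrie2016/A2Variants.lean`) holds UNCONDITIONALLY for blocks below N_* = 20/(sνϰ); what remains
    assumed is exactly `A2consumedFrom N_*` / `LLAstar` (the cell's (LLA_*), GAP.md addendum).
STATUS: unconditional theorems; they do NOT prove LLA or A2 (for n ≥ N_* the Weyl window δ + 2|γ|n′ exceeds the threshold
ε^{sϰn} by far and the bound is vacuous) — LLA for γ > 0 remains the unproved hypothesis of [ImbrieJSP2016] Thm 1.1
(cell verdict: open). Unit b2b-imbrie-1-g3 (gen 3 of the LLA seat).
-/

noncomputable section
open _root_.MeasureTheory Matrix Finset Filter Topology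
open scoped InnerProductSpace ENNReal

namespace Literature.MathematicalPhysics.QuantumLattice.Imbrie2016

variable {n : ℕ}

/-! ## A Schur test for real quadratic forms -/

/-- **Schur test (quadratic-form version).** If every row sum and every column sum of `|E|` is `≤ r`, then
`|Σ_σ Σ_τ x_σ E_στ x_τ| ≤ r Σ_σ x_σ²` (from `|x_σ x_τ| ≤ (x_σ² + x_τ²)/2`). [folklore] -/
theorem abs_sum_sum_mul_le_of_rowsum_le {ι : Type*} [Fintype ι] (E : Matrix ι ι ℝ) {r : ℝ}
    (hrow : ∀ σ, ∑ τ, |E σ τ| ≤ r) (hcol : ∀ τ, ∑ σ, |E σ τ| ≤ r) (x : ι → ℝ) :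
    |∑ σ, ∑ τ, x σ * E σ τ * x τ| ≤ r * ∑ σ, x σ ^ 2 := by
  have hterm : ∀ σ τ, |x σ * E σ τ * x τ| ≤ |E σ τ| * (x σ ^ 2 / 2) + |E σ τ| * (x τ ^ 2 / 2) := by
    intro σ τ
    rw [abs_mul, abs_mul]
    have h2 : 2 * (|x σ| * |x τ|) ≤ x σ ^ 2 + x τ ^ 2 := by
      have := two_mul_le_add_sq (|x σ|) (|x τ|)
      rw [sq_abs, sq_abs] at this; linarith
    have hE : 0 ≤ |E σ τ| := abs_nonneg _
    nlinarith
  have hS1 : ∑ σ, ∑ τ, |E σ τ| * (x σ ^ 2 / 2) ≤ ∑ σ, r * (x σ ^ 2 / 2) := by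
    refine Finset.sum_le_sum fun σ _ => ?_
    rw [← Finset.sum_mul]
    exact mul_le_mul_of_nonneg_right (hrow σ) (by positivity)
  have hS2 : ∑ σ, ∑ τ, |E σ τ| * (x τ ^ 2 / 2) ≤ ∑ τ, r * (x τ ^ 2 / 2) := by
    rw [Finset.sum_comm]
    refine Finset.sum_le_sum fun τ _ => ?_
    rw [← Finset.sum_mul]
    exact mul_le_mul_of_nonneg_right (hcol τ) (by positivity)
  calc |∑ σ, ∑ τ, x σ * E σ τ * x τ|
      ≤ ∑ σ, |∑ τ, x σ * E σ τ * x τ| := Finset.abs_sum_le_sum_abs _ _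
    _ ≤ ∑ σ, ∑ τ, |x σ * E σ τ * x τ| :=
        Finset.sum_le_sum fun σ _ => Finset.abs_sum_le_sum_abs _ _
    _ ≤ ∑ σ, ∑ τ, (|E σ τ| * (x σ ^ 2 / 2) + |E σ τ| * (x τ ^ 2 / 2)) :=
        Finset.sum_le_sum fun σ _ => Finset.sum_le_sum fun τ _ => hterm σ τ
    _ = ∑ σ, ∑ τ, |E σ τ| * (x σ ^ 2 / 2) + ∑ σ, ∑ τ, |E σ τ| * (x τ ^ 2 / 2) := by
        rw [← Finset.sum_add_distrib]
        exact Finset.sum_congr rfl fun σ _ => Finset.sum_add_distrib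
    _ ≤ ∑ σ, r * (x σ ^ 2 / 2) + ∑ τ, r * (x τ ^ 2 / 2) := add_le_add hS1 hS2
    _ = r * ∑ σ, x σ ^ 2 := by
        rw [← Finset.sum_add_distrib, Finset.mul_sum]
        exact Finset.sum_congr rfl fun σ _ => by ring

/-! ## The transverse part of (1.1): row sums and the quadratic-form bound |⟪x, γ Σ Γ_i S^x_i x⟫| ≤ |γ| Σ|Γ_i| ‖x‖² -/

/-- for a fixed configuration σ and site i there is at most one configuration "σ flipped exactly at i".
[cite: ImbrieJSP2016, eq. (1.1)] -/
theorem card_filter_flipAt_le_one (σ : Cfg n) (i : Fin n) :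
    (univ.filter fun τ => FlipAt σ τ i).card ≤ 1 := by
  refine Finset.card_le_one.mpr fun τ hτ τ' hτ' => ?_
  simp only [Finset.mem_filter, Finset.mem_univ, true_and] at hτ hτ'
  funext j
  by_cases hj : j = i
  · subst hj
    have h1 := hτ.1
    have h2 := hτ'.1
    cases hs : σ j <;> cases ht : τ j <;> cases ht' : τ' j <;> simp_all
  · rw [← hτ.2 j hj, ← hτ'.2 j hj]

/-- row sums of the transverse part: Σ_τ |(γ Σ_i Γ_i S^x_i)_{στ}| ≤ |γ| Σ_i |Γ_i|. [cite: ImbrieJSP2016, eq. (1.1)] -/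
theorem sum_abs_offDiag_le (γ : ℝ) (p : Params n) (σ : Cfg n) :
    ∑ τ, |offDiag γ p σ τ| ≤ |γ| * ∑ i, |p.Γ i| := by
  calc ∑ τ, |offDiag γ p σ τ|
      ≤ ∑ τ, ∑ i, (if FlipAt σ τ i then |γ * p.Γ i| else 0) := by
        refine Finset.sum_le_sum fun τ _ => ?_
        unfold offDiag
        refine (Finset.abs_sum_le_sum_abs _ _).trans (le_of_eq ?_)
        refine Finset.sum_congr rfl fun i _ => ?_
        split_ifs <;> simp
    _ = ∑ i, ∑ τ, (if FlipAt σ τ i then |γ * p.Γ i| else 0) := Finset.sum_comm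
    _ = ∑ i, ((univ.filter fun τ => FlipAt σ τ i).card : ℝ) * |γ * p.Γ i| := by
        refine Finset.sum_congr rfl fun i _ => ?_
        rw [Finset.sum_ite, Finset.sum_const_zero, add_zero, Finset.sum_const, nsmul_eq_mul]
    _ ≤ ∑ i, (1 : ℝ) * |γ * p.Γ i| := by
        refine Finset.sum_le_sum fun i _ => mul_le_mul_of_nonneg_right ?_ (abs_nonneg _)
        exact_mod_cast card_filter_flipAt_le_one σ i
    _ = |γ| * ∑ i, |p.Γ i| := by
        rw [Finset.mul_sum]
        exact Finset.sum_congr rfl fun i _ => by rw [one_mul, abs_mul]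

/-- column sums of the transverse part (it is symmetric). [cite: ImbrieJSP2016, eq. (1.1)] -/
theorem sum_abs_offDiag_le' (γ : ℝ) (p : Params n) (τ : Cfg n) :
    ∑ σ, |offDiag γ p σ τ| ≤ |γ| * ∑ i, |p.Γ i| := by
  calc ∑ σ, |offDiag γ p σ τ| = ∑ σ, |offDiag γ p τ σ| :=
        Finset.sum_congr rfl fun σ _ => by rw [offDiag_comm]
    _ ≤ |γ| * ∑ i, |p.Γ i| := sum_abs_offDiag_le γ p τ

/-- **Form bound for the transverse part**: |⟪x, (γ Σ_i Γ_i S^x_i) x⟫| ≤ |γ| (Σ_i |Γ_i|) ‖x‖² (Schur test).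
[cite: ImbrieJSP2016, eq. (1.1)] -/
theorem abs_re_inner_offDiag_le (γ : ℝ) (p : Params n) (x : EuclideanSpace ℝ (Cfg n)) :
    |RCLike.re ⟪x, toEuclideanLin (Matrix.of (offDiag γ p)) x⟫_ℝ| ≤ (|γ| * ∑ i, |p.Γ i|) * ‖x‖ ^ 2 := by
  have e : RCLike.re ⟪x, toEuclideanLin (Matrix.of (offDiag γ p)) x⟫_ℝ =
      ∑ σ, ∑ τ, x σ * offDiag γ p σ τ * x τ := by
    simp [Matrix.toLpLin_apply, PiLp.inner_apply, Matrix.mulVec, dotProduct, Finset.mul_sum, mul_comm,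
      mul_left_comm, mul_assoc]
  rw [e, EuclideanSpace.real_norm_sq_eq]
  exact abs_sum_sum_mul_le_of_rowsum_le (Matrix.of (offDiag γ p)) (fun σ => sum_abs_offDiag_le γ p σ)
    (fun τ => sum_abs_offDiag_le' γ p τ) x

/-! ## Weyl window: a small gap of H(γ) forces two configuration energies within δ + 2|γ| Σ|Γ_i| -/

/-- at γ = 0, counting eigenvalue indices with a property is counting configurations whose energy has it
(the multisets agree, `eigs_zero_multiset`). [cite: ImbrieJSP2016, eq. (1.1)] -/
theorem card_filter_eigs_zero_eq (p : Params n) (q : ℝ → Prop) [DecidablePred q] :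
    (univ.filter fun i => q (eigs 0 p i)).card = (univ.filter fun σ => q (diagEnergy p σ)).card := by
  have e1 := Multiset.countP_map (eigs 0 p) univ.val q
  have e2 := Multiset.countP_map (diagEnergy p) univ.val q
  rw [eigs_zero_multiset] at e1
  rw [Finset.card_def, Finset.filter_val, Finset.card_def, Finset.filter_val, ← e1, ← e2]

/-- **Weyl window (deterministic).** If two distinct eigenvalue indices of H(γ) are within δ, then two distinct
configurations have γ = 0 energies within δ + 2|γ| Σ_i |Γ_i| (Weyl monotonicity of the counting functions, Bhatia
Cor. III.2.6, between H(γ) and the diagonal H(0)). Audit-cell lemma (LLA.md §3 P2). [cite: ImbrieJSP2016, eq. (1.3)] -/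
theorem exists_cfg_pair_of_smallGap {γ δ : ℝ} {p : Params n} (h : SmallGap γ δ p) :
    ∃ σ τ : Cfg n, σ ≠ τ ∧
      |diagEnergy p σ - diagEnergy p τ| < δ + 2 * (|γ| * ∑ i, |p.Γ i|) := by
  obtain ⟨α, β, hne, hlt⟩ := h
  set t : ℝ := |γ| * ∑ i, |p.Γ i| with ht
  -- the two quadratic forms differ by at most t‖x‖²
  have hHB : H γ p = H 0 p + Matrix.of (offDiag γ p) := by rw [H_zero]; rfl
  have hform : ∀ x : EuclideanSpace ℝ (Cfg n),
      RCLike.re ⟪x, toEuclideanLin (H γ p) x⟫_ℝ = RCLike.re ⟪x, toEuclideanLin (H 0 p) x⟫_ℝ +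
        RCLike.re ⟪x, toEuclideanLin (Matrix.of (offDiag γ p)) x⟫_ℝ := by
    intro x
    rw [hHB, map_add, LinearMap.add_apply, inner_add_right, map_add]
  have hAB : ∀ x : EuclideanSpace ℝ (Cfg n), RCLike.re ⟪x, toEuclideanLin (H 0 p) x⟫_ℝ ≤
      RCLike.re ⟪x, toEuclideanLin (H γ p) x⟫_ℝ + t * ‖x‖ ^ 2 := by
    intro x
    have h1 := (abs_le.mp (abs_re_inner_offDiag_le γ p x)).1
    rw [hform]; linarith
  have hBA : ∀ x : EuclideanSpace ℝ (Cfg n), RCLike.re ⟪x, toEuclideanLin (H γ p) x⟫_ℝ ≤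
      RCLike.re ⟪x, toEuclideanLin (H 0 p) x⟫_ℝ + t * ‖x‖ ^ 2 := by
    intro x
    have h1 := (abs_le.mp (abs_re_inner_offDiag_le γ p x)).2
    rw [hform]; linarith
  -- the window [lo, hi] of H(γ) containing α and β
  set lo : ℝ := min (eigs γ p α) (eigs γ p β) with hlo
  set hi : ℝ := max (eigs γ p α) (eigs γ p β) with hhi
  have hhilo : hi - lo < δ := by rw [hhi, hlo, max_sub_min_eq_abs']; exact hlt
  have hcountA : (univ.filter fun i => eigs γ p i < lo).card + 2 ≤ (univ.filter fun i => eigs γ p i ≤ hi).card := by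
    have hsub : (univ.filter fun i => eigs γ p i < lo) ∪ {α, β} ⊆ (univ.filter fun i => eigs γ p i ≤ hi) := by
      intro i hi'
      simp only [Finset.mem_union, Finset.mem_filter, Finset.mem_univ, true_and, Finset.mem_insert,
        Finset.mem_singleton] at hi' ⊢
      rcases hi' with h | rfl | rfl
      · exact (h.le.trans (min_le_left _ _)).trans (le_max_left _ _)
      · exact le_max_left _ _
      · exact le_max_right _ _
    have hdisj : Disjoint (univ.filter fun i => eigs γ p i < lo) {α, β} := by
      rw [Finset.disjoint_left]
      intro i hi1 hi2
      simp only [Finset.mem_filter, Finset.mem_univ, true_and] at hi1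
      simp only [Finset.mem_insert, Finset.mem_singleton] at hi2
      rcases hi2 with rfl | rfl
      · exact absurd (min_le_left _ _) (not_le.mpr hi1)
      · exact absurd (min_le_right _ _) (not_le.mpr hi1)
    calc (univ.filter fun i => eigs γ p i < lo).card + 2
        = ((univ.filter fun i => eigs γ p i < lo) ∪ {α, β}).card := by
          rw [Finset.card_union_of_disjoint hdisj, Finset.card_pair hne]
      _ ≤ _ := Finset.card_le_card hsub
  -- Weyl monotonicity in both directions
  have hW1 : (univ.filter fun i => eigs γ p i ≤ hi).card ≤ (univ.filter fun i => eigs 0 p i ≤ hi + t).card :=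
    card_eigenvalues_le_le_card_of_forms (H_isHermitian γ p) (H_isHermitian 0 p) hAB hi
  have hW2 : (univ.filter fun i => eigs 0 p i < lo - t).card ≤ (univ.filter fun i => eigs γ p i < lo).card := by
    have := card_eigenvalues_lt_le_card_of_forms (H_isHermitian 0 p) (H_isHermitian γ p) hBA (lo - t)
    rw [sub_add_cancel] at this
    exact this
  -- transfer to configurations at γ = 0
  have hC1 := card_filter_eigs_zero_eq p (fun v => v ≤ hi + t)
  have hC2 := card_filter_eigs_zero_eq p (fun v => v < lo - t)
  have hwin : 1 < (univ.filter fun σ => lo - t ≤ diagEnergy p σ ∧ diagEnergy p σ ≤ hi + t).card := by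
    have hsub : (univ.filter fun σ => diagEnergy p σ ≤ hi + t) ⊆
        (univ.filter fun σ => diagEnergy p σ < lo - t) ∪
          (univ.filter fun σ => lo - t ≤ diagEnergy p σ ∧ diagEnergy p σ ≤ hi + t) := by
      intro σ hσ
      simp only [Finset.mem_union, Finset.mem_filter, Finset.mem_univ, true_and] at hσ ⊢
      by_cases hlt' : diagEnergy p σ < lo - t
      · exact Or.inl hlt'
      · exact Or.inr ⟨not_lt.mp hlt', hσ⟩
    have := (Finset.card_le_card hsub).trans (Finset.card_union_le _ _)
    omega
  obtain ⟨σ, hσ, τ, hτ, hστ⟩ := Finset.one_lt_card.mp hwin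
  simp only [Finset.mem_filter, Finset.mem_univ, true_and] at hσ hτ
  refine ⟨σ, τ, hστ, ?_⟩
  rw [abs_lt]
  constructor <;> linarith [hσ.1, hσ.2, hτ.1, hτ.2]

/-! ## P2: the probabilistic Weyl window -/

/-- an admissible law is carried by [−1, 1]. [cite: ImbrieJSP2016, p. 1000] -/
theorem Admissible.measure_compl_Icc {ρ₀ : ℝ} {μ : Measure ℝ} (hμ : Admissible ρ₀ μ) :
    μ (Set.Icc (-1 : ℝ) 1)ᶜ = 0 := by
  have h1 := (Measure.le_iff'.1 hμ.2) (Set.Icc (-1 : ℝ) 1)ᶜ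
  rw [Measure.smul_apply, smul_eq_mul, Measure.restrict_apply (measurableSet_Icc.compl),
    Set.compl_inter_self, measure_empty, mul_zero] at h1
  exact le_antisymm h1 bot_le

/-- under admissible laws, almost surely every |Γ_i| ≤ 1 (the exceptional set is null for the box measure).
[cite: ImbrieJSP2016, p. 1000] -/
theorem boxMeasure_not_forall_Gamma_mem_Icc {L : Laws} {ρ₀ : ℝ} (hL : L.Admissible ρ₀) (a : ℤ) (n : ℕ) :
    L.boxMeasure a n {t | ¬ ∀ i, t.2.1 i ∈ Set.Icc (-1 : ℝ) 1} = 0 := by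
  haveI : ∀ k, IsProbabilityMeasure (L.μh k) := fun k => (hL k).1.1
  haveI : ∀ k, IsProbabilityMeasure (L.μΓ k) := fun k => (hL k).2.1.1
  haveI : ∀ k, IsProbabilityMeasure (L.μJ k) := fun k => (hL k).2.2.1
  have hΓ : (Measure.pi fun i : Fin n => L.μΓ (a + i)) {g | ¬ ∀ i, g i ∈ Set.Icc (-1 : ℝ) 1} = 0 := by
    have e : {g : Fin n → ℝ | ¬ ∀ i, g i ∈ Set.Icc (-1 : ℝ) 1} =
        ⋃ i, Function.eval i ⁻¹' (Set.Icc (-1 : ℝ) 1)ᶜ := by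
      ext g; simp
    rw [e]
    exact measure_iUnion_null fun i => Measure.pi_eval_preimage_null _ (hL (a + i)).2.1.measure_compl_Icc
  have hS : {t : (Fin n → ℝ) × (Fin n → ℝ) × (Fin (n + 1) → ℝ) | ¬ ∀ i, t.2.1 i ∈ Set.Icc (-1 : ℝ) 1}
      = Set.univ ×ˢ ({g : Fin n → ℝ | ¬ ∀ i, g i ∈ Set.Icc (-1 : ℝ) 1} ×ˢ Set.univ) := by
    ext t; simp
  unfold Laws.boxMeasure
  rw [hS, Measure.prod_prod, Measure.prod_prod, hΓ, zero_mul, mul_zero]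

/-- **P2 of the audit cell (LLA.md §3, REPAIR-CENSUS V10): the Weyl window.** For laws admissible with density bound
ρ₀ ≥ 0 and EVERY coupling γ, box [a, a+n−1] and real δ:  P_γ(∃ α ≠ β : |E_α − E_β| < δ) ≤ ρ₀ 4ⁿ (δ + 2|γ| n).
Informative only for δ ≳ γn; it does not touch LLA (whose content is δ ≪ γ). [cite: ImbrieJSP2016, eq. (1.3)] -/
theorem boxMeasure_smallGap_le {L : Laws} {ρ₀ : ℝ} (hL : L.Admissible ρ₀) (hρ : 0 ≤ ρ₀) (γ : ℝ) (a : ℤ)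
    (n : ℕ) (δ : ℝ) :
    L.boxMeasure a n {t | SmallGap γ δ (Params.ofTriple t)}
      ≤ ENNReal.ofReal (ρ₀ * 4 ^ n * (δ + 2 * |γ| * n)) := by
  have hsub : {t : (Fin n → ℝ) × (Fin n → ℝ) × (Fin (n + 1) → ℝ) | SmallGap γ δ (Params.ofTriple t)} ⊆
      {t | ∃ σ τ : Cfg n, σ ≠ τ ∧
          |diagEnergy (Params.ofTriple t) σ - diagEnergy (Params.ofTriple t) τ| ≤ δ + 2 * |γ| * n} ∪
        {t | ¬ ∀ i, t.2.1 i ∈ Set.Icc (-1 : ℝ) 1} := by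
    intro t ht
    by_cases hG : ∀ i, t.2.1 i ∈ Set.Icc (-1 : ℝ) 1
    · left
      obtain ⟨σ, τ, hne, hlt⟩ := exists_cfg_pair_of_smallGap ht
      refine ⟨σ, τ, hne, hlt.le.trans ?_⟩
      have hsum : ∑ i, |(Params.ofTriple t).Γ i| ≤ n := by
        calc ∑ i, |(Params.ofTriple t).Γ i| ≤ ∑ _i : Fin n, (1 : ℝ) :=
              Finset.sum_le_sum fun i _ => abs_le.mpr (by simpa [Params.ofTriple] using hG i)
          _ = n := by simp
      nlinarith [abs_nonneg γ]
    · right; exact hG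
  calc L.boxMeasure a n {t | SmallGap γ δ (Params.ofTriple t)}
      ≤ L.boxMeasure a n ({t | ∃ σ τ : Cfg n, σ ≠ τ ∧
            |diagEnergy (Params.ofTriple t) σ - diagEnergy (Params.ofTriple t) τ| ≤ δ + 2 * |γ| * n} ∪
          {t | ¬ ∀ i, t.2.1 i ∈ Set.Icc (-1 : ℝ) 1}) := measure_mono hsub
    _ ≤ L.boxMeasure a n {t | ∃ σ τ : Cfg n, σ ≠ τ ∧
            |diagEnergy (Params.ofTriple t) σ - diagEnergy (Params.ofTriple t) τ| ≤ δ + 2 * |γ| * n} +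
          L.boxMeasure a n {t | ¬ ∀ i, t.2.1 i ∈ Set.Icc (-1 : ℝ) 1} := measure_union_le _ _
    _ ≤ ENNReal.ofReal (ρ₀ * 4 ^ n * (δ + 2 * |γ| * n)) := by
        rw [boxMeasure_not_forall_Gamma_mem_Icc hL a n, add_zero]
        exact boxMeasure_cfgClose_le hL hρ a n _

/-- P2 in LLA currency: for 0 ≤ γ and δ ≥ 2γn one has P_γ(min gap < δ) ≤ 2ρ₀ 4ⁿ δ, i.e. the LLA inequality with ν = 1
holds at all scales δ ≥ 2γn with C = 8 max(1, ρ₀) (REPAIR-CENSUS V10: "for every n it is a theorem at scales δ ≥ 2γ|Λ′|").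
[cite: ImbrieJSP2016, eq. (1.3)] -/
theorem boxMeasure_smallGap_le_of_le {L : Laws} {ρ₀ : ℝ} (hL : L.Admissible ρ₀) (hρ : 0 ≤ ρ₀) {γ : ℝ}
    (hγ : 0 ≤ γ) (a : ℤ) (n : ℕ) {δ : ℝ} (hδ : 2 * γ * n ≤ δ) :
    L.boxMeasure a n {t | SmallGap γ δ (Params.ofTriple t)} ≤ ENNReal.ofReal (2 * ρ₀ * 4 ^ n * δ) := by
  refine (boxMeasure_smallGap_le hL hρ γ a n δ).trans (ENNReal.ofReal_le_ofReal ?_)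
  rw [abs_of_nonneg hγ]
  have h4 : (0 : ℝ) ≤ ρ₀ * 4 ^ n := by positivity
  nlinarith

/-! ## Small blocks are free: the consumed instance of A2 below N_* = 20/(sνϰ) -/

/-- the real-variable heart of "small blocks are free": for ν < 1, s, ϰ > 0 and sνϰn < 20 (n ≥ 1), eventually as γ → 0⁺,
ρ₀ 4^{n′} (ε^{sϰn} + 2|γ| n′) ≤ ε^{sνϰn} with ε = γ^{1/20} (the threshold term is beaten because ν < 1, the Weyl term
because sνϰn/20 < 1; any real ρ₀). [cite: ImbrieJSP2016, §5 proof of Thm 5.1] -/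
theorem eventually_weylWindow_le_consumedBound (ρ₀ : ℝ) {ν s ϰ : ℝ} (hν1 : ν < 1)
    (hs : 0 < s) (hϰ : 0 < ϰ) {n : ℕ} (hn : 0 < n) (hB : s * ν * ϰ * n < 20) (n' : ℕ) :
    ∀ᶠ γ : ℝ in 𝓝[>] 0,
      ρ₀ * 4 ^ n' * ((γ ^ (1 / 20 : ℝ)) ^ (s * ϰ * n) + 2 * |γ| * n') ≤
        (γ ^ (1 / 20 : ℝ)) ^ (s * ν * ϰ * n) := by
  set A : ℝ := 1 / 20 * (s * ϰ * n) with hA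
  set B : ℝ := 1 / 20 * (s * ν * ϰ * n) with hBdef
  have hnR : (0 : ℝ) < n := by exact_mod_cast hn
  have hAB : 0 < A - B := by
    have e : A - B = 1 / 20 * (s * ϰ * n) * (1 - ν) := by rw [hA, hBdef]; ring
    rw [e]
    have : 0 < 1 - ν := by linarith
    positivity
  have hB1 : 0 < 1 - B := by
    have e : B = s * ν * ϰ * n / 20 := by rw [hBdef]; ring
    rw [e]; linarith
  have ev1 : ∀ᶠ γ : ℝ in 𝓝[>] 0, ρ₀ * 4 ^ n' * γ ^ (A - B) ≤ 1 / 2 := by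
    have h1 : Tendsto (fun γ : ℝ => ρ₀ * 4 ^ n' * γ ^ (A - B)) (𝓝 0)
        (𝓝 (ρ₀ * 4 ^ n' * (0 : ℝ) ^ (A - B))) :=
      ((Real.continuousAt_rpow_const 0 (A - B) (Or.inr hAB.le)).tendsto).const_mul _
    rw [Real.zero_rpow hAB.ne', mul_zero] at h1
    exact (tendsto_nhdsWithin_of_tendsto_nhds h1).eventually_le_const (by norm_num)
  have ev2 : ∀ᶠ γ : ℝ in 𝓝[>] 0, 2 * ρ₀ * 4 ^ n' * n' * γ ^ (1 - B) ≤ 1 / 2 := by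
    have h1 : Tendsto (fun γ : ℝ => 2 * ρ₀ * 4 ^ n' * n' * γ ^ (1 - B)) (𝓝 0)
        (𝓝 (2 * ρ₀ * 4 ^ n' * n' * (0 : ℝ) ^ (1 - B))) :=
      ((Real.continuousAt_rpow_const 0 (1 - B) (Or.inr hB1.le)).tendsto).const_mul _
    rw [Real.zero_rpow hB1.ne', mul_zero] at h1
    exact (tendsto_nhdsWithin_of_tendsto_nhds h1).eventually_le_const (by norm_num)
  have ev0 : ∀ᶠ γ : ℝ in 𝓝[>] 0, 0 < γ := eventually_mem_nhdsWithin
  filter_upwards [ev0, ev1, ev2] with γ hγ h1 h2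
  have hγB : 0 < γ ^ B := Real.rpow_pos_of_pos hγ B
  have eA : (γ ^ (1 / 20 : ℝ)) ^ (s * ϰ * n) = γ ^ B * γ ^ (A - B) := by
    rw [← Real.rpow_mul hγ.le, ← Real.rpow_add hγ, ← hA]
    congr 1; ring
  have eB : (γ ^ (1 / 20 : ℝ)) ^ (s * ν * ϰ * n) = γ ^ B := by
    rw [← Real.rpow_mul hγ.le]
  have e1 : γ ^ B * γ ^ (1 - B) = γ := by
    rw [← Real.rpow_add hγ, add_sub_cancel, Real.rpow_one]
  rw [eA, eB, abs_of_pos hγ]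
  calc ρ₀ * 4 ^ n' * (γ ^ B * γ ^ (A - B) + 2 * γ * n')
      = ρ₀ * 4 ^ n' * (γ ^ B * γ ^ (A - B) + 2 * (γ ^ B * γ ^ (1 - B)) * n') := by rw [e1]
    _ = γ ^ B * (ρ₀ * 4 ^ n' * γ ^ (A - B) + 2 * ρ₀ * 4 ^ n' * n' * γ ^ (1 - B)) := by ring
    _ ≤ γ ^ B * (1 / 2 + 1 / 2) := mul_le_mul_of_nonneg_left (add_le_add h1 h2) hγB.le
    _ = γ ^ B := by ring

/-- **Small blocks are free** (audit cell, LLA.md §3 P2 / REPAIR-CENSUS V10, complementing `A2consumedFrom` / `LLAstar` of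
`Imbrie2016/A2Variants.lean`): for 0 < ν < 1, s, ϰ > 0, a collar multiple m and N with sνϰN ≤ 20, there is γ₀ > 0 such that
for every γ ∈ (0, γ₀], every block of n sites with 1 ≤ n < N and every box of n′ ∈ [n, mn] sites the consumed instance
P_γ(min gap < ε^{sϰn}) ≤ ε^{sνϰn} (ε = γ^{1/20}) HOLDS — unconditionally, by the Weyl window and the γ = 0 count. What Thm 1.1
still needs as a hypothesis is the same bound for blocks of n ≥ N_* = 20/(sνϰ) sites. [cite: ImbrieJSP2016, §5 proof of Thm 5.1] -/
theorem smallBlocks_consumedA2 {L : Laws} {ρ₀ : ℝ} (hL : L.Admissible ρ₀) (hρ : 0 ≤ ρ₀) {ν s ϰ : ℝ}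
    (hν : 0 < ν) (hν1 : ν < 1) (hs : 0 < s) (hϰ : 0 < ϰ) (m N : ℕ) (hN : s * ν * ϰ * N ≤ 20) :
    ∃ γ₀ > 0, ∀ γ : ℝ, 0 < γ → γ ≤ γ₀ →
      ∀ (a : ℤ) (n n' : ℕ), 0 < n → n < N → n ≤ n' → n' ≤ m * n →
        L.boxMeasure a n' {t | SmallGap γ ((γ ^ (1 / 20 : ℝ)) ^ (s * ϰ * n)) (Params.ofTriple t)}
          ≤ ENNReal.ofReal ((γ ^ (1 / 20 : ℝ)) ^ (s * ν * ϰ * n)) := by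
  have hev : ∀ᶠ γ : ℝ in 𝓝[>] 0, ∀ n ∈ Finset.range N, ∀ n' ∈ Finset.range (m * N + 1), 0 < n →
      ρ₀ * 4 ^ n' * ((γ ^ (1 / 20 : ℝ)) ^ (s * ϰ * n) + 2 * |γ| * n') ≤
        (γ ^ (1 / 20 : ℝ)) ^ (s * ν * ϰ * n) := by
    refine (Filter.eventually_all_finset _).mpr fun n hn =>
      (Filter.eventually_all_finset _).mpr fun n' _ => ?_
    rcases Nat.eq_zero_or_pos n with h0 | hpos
    · exact Filter.Eventually.of_forall fun γ h => absurd h (by omega)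
    · have hnN : n < N := Finset.mem_range.mp hn
      have hB : s * ν * ϰ * n < 20 := by
        have hnN' : (n : ℝ) < N := by exact_mod_cast hnN
        have : s * ν * ϰ * n < s * ν * ϰ * N := mul_lt_mul_of_pos_left hnN' (by positivity)
        linarith
      exact (eventually_weylWindow_le_consumedBound ρ₀ hν1 hs hϰ hpos hB n').mono fun γ h _ => h
  obtain ⟨γ₀, hγ₀, hsub⟩ := mem_nhdsGT_iff_exists_Ioc_subset.mp hev
  refine ⟨γ₀, hγ₀, fun γ hγ hγle a n n' hn hnN hnn' hn'm => ?_⟩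
  have hn'r : n' ∈ Finset.range (m * N + 1) :=
    Finset.mem_range.mpr (Nat.lt_succ_of_le (hn'm.trans (Nat.mul_le_mul_left m hnN.le)))
  have hineq := hsub ⟨hγ, hγle⟩ n (Finset.mem_range.mpr hnN) n' hn'r hn
  exact (boxMeasure_smallGap_le hL hρ γ a n' _).trans (ENNReal.ofReal_le_ofReal hineq)

end Literature.MathematicalPhysics.QuantumLattice.Imbrie2016
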